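import Literature.AlgebraicGeometry.Pohlmann1968.SimpleDegenerateCMAbelianVarietiesCompositeDimension
import Literature.NumberTheory.ComplexMultiplication.AbelianCMFieldsCyclicOverImaginaryQuadratic
import Literature.AlgebraicGeometry.Pohlmann1968.NondegenerateCMTypeHodgeConjecture
import Literature.AlgebraicGeometry.ComplexMultiplication.CMAbelianVarietyRealisedHolds
import HarnessLib

/-!
# Dodson 1987, Theorem 1.0 (i): `n + 1 ∈ S(n)` for every `n` — in every dimension there is a SIMPLE abelian variety
# of CM type which is NONDEGENERATE (and satisfies the Hodge conjecture together with all its powers)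

B. Dodson, *On the Mumford–Tate group of an abelian variety with complex multiplication*, J. Algebra **111** (1987)
49–73 [Dodson1987] (held text `paper:doi-10-1016-0021-8693-87-90242-0`), p. 49 and p. 51:

> "Let `(K, Φ)` be a primitive CM-type with `[K : ℚ] = 2n` […]. Fix `n`, and consider the collection
> `S(n) = {Rank(Φ)}`, where […] `(K, Φ)` ranges over all primitive types."
> "THEOREM 1.0. (i) `n + 1 ∈ S(n)`, for every `n`. (ii) `t ∈ S(n)` implies `t ≤ n + 1`. […]"

((ii) is the tree's `cmTypeRank_le`; (iii), (v) are `Pohlmann1968/CMTypeRankLowerBoundsNumberField`,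
`typeRank_eq_of_prime_of_isPrimitive`.)  This file proves (i) for `n ≥ 3` by Dodson's own fields and types
[Dodson1984, §3.2.1] already in the tree: an abelian CM field `K` with `Gal(K/ℚ) = ⟨ρ⟩ × ℤₙ`
(`Dodson1984.exists_abelianCMField_gal_cyclicTimesConj`) and the block type `Φᶠ`, `f = (1, 0, …, 0)` of weight
`l = 1` (`exists_cmType_blockType`), whose rank is `n − l + 2 = n + 1` (`cmTypeRank_blockType`, the constant weight
criterion) and which is primitive for `2l < n` (`isPrimitive_blockType`).  PROVED (theorems only; no definition,
no named fact):

* **`exists_isPrimitive_isNondegenerate`** — Thm. 1.0 (i), `n ≥ 3`: a CM field `K` of degree `2n` and a PRIMITIVE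
  CM type `Φ` of `K` with `Rank(K; Φ) = n + 1` (NONDEGENERATE); every abelian variety of type `(K; Φ)` is SIMPLE
  of dimension `n` and satisfies the Hodge conjecture together with all its powers (Pohlmann–White–Hazama, tree
  `IsNondegenerate.hodgeConjectureFor_pow`);
* **`exists_isSimple_isNondegenerate_hodgeConjectureFor_pow`** — on the varieties: for every `n ≥ 3` there is a
  simple abelian variety of CM type and dimension `n` whose type is nondegenerate (`dim MT = n + 1`) and all of
  whose powers satisfy the Hodge conjecture, unconditionally (realisations exist: Shimura §6.2 Thm. 3, tree
  `exists_isCMTypeRealisation`).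

NOT here: `n ≤ 2` (imaginary quadratic fields; cyclic quartic CM fields — tree `QuarticCMTypes`), and (iv)
(`B(2ʲ) = j + 2`).

## References
* [Dodson1987] B. Dodson, J. Algebra 111 (1987), Thm. 1.0 (i) (p. 51), §1.1 (p. 50).
* [Dodson1984] B. Dodson, Trans. AMS 283 (1984), §3.1.1, §3.2.1 (the fields `⟨ρ⟩ × ℤₙ` and the block types).
* [Shimura1998] G. Shimura, *Abelian varieties with complex multiplication and modular functions*, §6.2 Thm. 3,
  §8.2 Prop. 26.
* [Gordon1999HodgeAVSurvey] B. B. Gordon, *A survey of the Hodge conjecture for abelian varieties*, Thm. 6.4, §9.3.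
-/

set_option autoImplicit false

noncomputable section

open scoped BigOperators NumberField
open CategoryTheory NumberField

namespace Literature.AlgebraicGeometry.Pohlmann1968

open Literature.NumberTheory.ComplexMultiplication
open Literature.NumberTheory.ComplexMultiplication.Dodson1984
open Literature.AlgebraicGeometry.Motives (AbelianVariety CMType)
open Literature.AlgebraicGeometry.HodgeTheory
open Literature.AlgebraicGeometry.ComplexMultiplication (IsCMTypeRealisation isSimple_iff_isPrimitive
  exists_isCMTypeRealisation)

/-- **Dodson 1987, Theorem 1.0 (i) (`n ≥ 3`): `n + 1 ∈ S(n)`** — there are a CM field `K` with `[K : ℚ] = 2n` and a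
PRIMITIVE CM type `Φ` of `K` of rank `Rank(K; Φ) = n + 1`, i.e. NONDEGENERATE; every abelian variety of CM type
`(K; Φ)` is simple of dimension `n` and satisfies the Hodge conjecture with all its powers.  (`K` abelian with
`Gal(K/ℚ) = ⟨ρ⟩ × ℤₙ`, `Φ = Φᶠ` with `f = (1, 0, …, 0)`: `Rank = n − 1 + 2`.)
[cite: Dodson1987, Thm. 1.0 (i)] [cite: Dodson1984, §3.2.1 Theorem (proof)] -/
theorem exists_isPrimitive_isNondegenerate (n : ℕ) (hn : 3 ≤ n) :
    ∃ (K : Type) (_ : Field K) (_ : NumberField K) (_ : IsCMField K) (Φ : CMType K) (φ₀ : K →+* ℂ),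
      Module.finrank ℚ K = 2 * n ∧ IsPrimitive (ℂ ≃+* ℂ) Φ.1 φ₀ ∧ cmTypeRank Φ = n + 1 ∧ IsNondegenerate Φ ∧
        ∀ (A : AbelianVariety ℂ) (ι : 𝓞 K →+* End A) (θ : K →+* Module.End ℂ (complexBetti A.X 1)),
          IsCMTypeRealisation Φ A ι θ →
            A.IsSimple ∧ A.dim = n ∧
              ∀ r : ℕ, HodgeConjectureFor (⨁ fun _ : Fin r => A).dim (⨁ fun _ : Fin r => A).X := by
  obtain ⟨K, _, _, _, _, ρ, σ, φ₀, hcomm, hρ, hσ, hρσ, hK⟩ :=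
    exists_abelianCMField_gal_cyclicTimesConj n (by omega)
  obtain ⟨Φ, hΦσ, hΦρ⟩ := exists_cmType_blockType hcomm hρ hσ hρσ hK 1
  have hrank : cmTypeRank Φ = n + 1 := by
    rw [cmTypeRank_blockType hcomm hρ hσ hρσ hK hΦσ hΦρ one_pos (one_dvd n) (by omega)]; omega
  have hnd : IsNondegenerate Φ := by
    rw [isNondegenerate_iff, hrank, hK]; omega
  have hprim : ∀ φ : K →+* ℂ, IsPrimitive (ℂ ≃+* ℂ) Φ.1 φ := fun φ =>
    isPrimitive_blockType hcomm hρ hσ hρσ hK hΦσ hΦρ one_pos (by omega) φ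
  refine ⟨K, inferInstance, inferInstance, inferInstance, Φ, φ₀, hK, hprim φ₀, hrank, hnd, fun A ι θ hA => ?_⟩
  exact ⟨(isSimple_iff_isPrimitive hA φ₀).2 (hprim φ₀), dim_eq_blockType hK hA,
    fun r => hnd.hodgeConjectureFor_pow hA r⟩

/-- **Theorem 1.0 (i) on the varieties (`n ≥ 3`)**: there is a SIMPLE abelian variety `A` of CM type `(K; Φ)` and
dimension `n` whose type is NONDEGENERATE (`Rank(K; Φ) = n + 1 = dim MT(A)`), and `A` and all its powers satisfy
the Hodge conjecture — unconditionally (the realisation exists by Shimura §6.2 Thm. 3).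
[cite: Dodson1987, Thm. 1.0 (i)] [cite: Shimura1998, §6.2 Thm. 3] -/
theorem exists_isSimple_isNondegenerate_hodgeConjectureFor_pow (n : ℕ) (hn : 3 ≤ n) :
    ∃ (K : Type) (_ : Field K) (_ : NumberField K) (_ : IsCMField K) (Φ : CMType K) (A : AbelianVariety ℂ)
      (ι : 𝓞 K →+* End A) (θ : K →+* Module.End ℂ (complexBetti A.X 1)),
      IsCMTypeRealisation Φ A ι θ ∧ Module.finrank ℚ K = 2 * n ∧ IsNondegenerate Φ ∧ A.IsSimple ∧ A.dim = n ∧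
        ∀ r : ℕ, HodgeConjectureFor (⨁ fun _ : Fin r => A).dim (⨁ fun _ : Fin r => A).X := by
  obtain ⟨K, _, _, _, Φ, φ₀, hK, -, -, hnd, hAV⟩ := exists_isPrimitive_isNondegenerate n hn
  obtain ⟨A, ι, θ, hA⟩ := exists_isCMTypeRealisation Φ
  obtain ⟨hs, hd, hHC⟩ := hAV A ι θ hA
  exact ⟨K, inferInstance, inferInstance, inferInstance, Φ, A, ι, θ, hA, hK, hnd, hs, hd, hHC⟩

end Literature.AlgebraicGeometry.Pohlmann1968

end
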